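import Mathlib.MeasureTheory.Integral.DominatedConvergence
import Mathlib.Topology.UniformSpace.HeineCantor
import Literature.MathematicalPhysics.QuantumLattice.DWaveSourceFreePressure

/-!
# Crux `TwSeededEnsembleEquivalenceR` (stmt-HubbardSuperconductivity-15581), line `cold-floor-collapse`
# (slug `Sketch`) — thermodynamic limit of the FREE `d`-wave-sourced BdG pressure

Support file (`--supports stmt-HubbardSuperconductivity-15581`; sorry-free; no definition) for the
free-gas stub `stub_freeColdEdgeIncrements` (S4b). Layer 1 of that stub: the `U = 0` sourced torus
pressure `p_L(β,μ,s) = log Re Tr e^{-β H_L(s)} / (βL²)`, `H_L(s) = dWaveSourceTorus L 0 μ s`, converges as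
`L → ∞` to the Brillouin-zone average of the BdG pressure density

  `F(θ) = 2 log 2/β − ξ(θ) + (1/β) log((1 + cosh(β E(θ)))/2)`,
  `ξ(θ) = −2(cos θ₁ + cos θ₂) − μ`, `E(θ)² = ξ(θ)² + 8 s² (cos θ₁ − cos θ₂)²`

(`cfl_freeSourcedPressure_limit`, registered helper stub; `ε`–`L₀` form matching the hypothesis shape of
`stub_freeColdEdgeIncrements`). Ingredients: the PROVED closed form `partitionFn_dWaveSourceTorus_zero_re`
(`Tr e^{-βH_L(s)} = 2^{2L²} Π_k e^{-βξ_k}(1 + cosh βE_k)/2`, `L ≥ 3`), which makes `p_L` the uniform-grid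
average of `F` over the lattice momenta (`cfl_freeSourcedPressure_eq_gridAverage`), and a self-contained
two-dimensional Riemann-sum lemma for jointly continuous functions on the torus grid
(`cfl_riemann_sum_torus`). [folklore: BCS/BdG mean-field pressure in the thermodynamic limit,
de Gennes 1966 Ch. 4; von Delft–Ralph 2001 §4.2]
-/

set_option linter.dupNamespace false

namespace Summit.HubbardSuperconductivity.HubbardSuperconductivity.Theorems.TwSeededEnsembleEquivalenceR.ColdFloorLine

open Matrix Finset Literature.MathematicalPhysics.QuantumLattice Literature.Probability.LatticeModels
open scoped ComplexOrder
open Real MeasureTheory intervalIntegral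

/-! ### Generic: Riemann sums on the torus grid -/


/-- Sums over `Fin 2 → ZMod (n+1)` of a function of the two residues' values are double `range` sums. [folklore] -/
theorem cfl_sum_torus_eq_sum_range (n : ℕ) (g : ℕ → ℕ → ℝ) :
    ∑ k : Fin 2 → ZMod (n + 1), g (k 0).val (k 1).val =
      ∑ i ∈ range (n + 1), ∑ j ∈ range (n + 1), g i j := by
  rw [← (piFinTwoEquiv fun _ => ZMod (n + 1)).symm.sum_comp]
  rw [Fintype.sum_prod_type]
  simp only [piFinTwoEquiv_symm_apply, Fin.cons_zero, Fin.cons_one]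
  change ∑ x : Fin (n + 1), ∑ y : Fin (n + 1), g x.val y.val = _
  rw [Fin.sum_univ_eq_sum_range (fun i => ∑ y : Fin (n + 1), g i y.val) (n + 1)]
  refine Finset.sum_congr rfl fun i _ => ?_
  exact Fin.sum_univ_eq_sum_range (fun j => g i j) (n + 1)

/-- **Riemann sums on the torus grid.** For `f : ℝ → ℝ → ℝ` jointly continuous,
`(1/L²) Σ_{k ∈ (ℤ/L)²} f(2πk₁/L, 2πk₂/L) → (1/4π²) ∫₀^{2π}∫₀^{2π} f` as `L → ∞` (`ε`–`L₀` form): uniform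
continuity on the compact square and the cell-by-cell estimate `|∫∫_cell f − (2π/L)² f(corner)| ≤ κ (2π/L)²`.
[folklore: Riemann sums of continuous functions] -/
theorem cfl_riemann_sum_torus {f : ℝ → ℝ → ℝ} (hf : Continuous (Function.uncurry f)) :
    ∀ κ : ℝ, 0 < κ → ∃ L₀ : ℕ, ∀ (L : ℕ) [NeZero L], L₀ ≤ L →
      |(∑ k : Fin 2 → ZMod L, f (2 * π * ((k 0).val : ℝ) / L) (2 * π * ((k 1).val : ℝ) / L)) /
            (L : ℝ) ^ 2 -
          (∫ x in (0 : ℝ)..2 * π, ∫ y in (0 : ℝ)..2 * π, f x y) / (4 * π ^ 2)| ≤ κ := by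
  intro κ hκ
  -- uniform continuity on the compact square
  set K : Set (ℝ × ℝ) := Set.Icc (0 : ℝ) (2 * π) ×ˢ Set.Icc (0 : ℝ) (2 * π) with hK
  have hKc : IsCompact K := isCompact_Icc.prod isCompact_Icc
  have huc : UniformContinuousOn (Function.uncurry f) K :=
    hKc.uniformContinuousOn_of_continuous hf.continuousOn
  obtain ⟨δ, hδ, hδf⟩ := Metric.uniformContinuousOn_iff.1 huc κ hκ
  obtain ⟨L₀, hL₀⟩ := exists_nat_gt (2 * π / δ)
  refine ⟨L₀, fun L _ hL => ?_⟩
  obtain ⟨n, rfl⟩ := Nat.exists_eq_succ_of_ne_zero (NeZero.ne L)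
  have hLpos : (0 : ℝ) < (n + 1 : ℕ) := by exact_mod_cast Nat.succ_pos n
  set d : ℝ := 2 * π / (n + 1 : ℕ) with hd
  have hdpos : 0 < d := div_pos two_pi_pos hLpos
  have hdδ : d < δ := by
    rw [hd, div_lt_iff₀ hLpos]
    have : 2 * π / δ < (n + 1 : ℕ) := lt_of_lt_of_le hL₀ (by exact_mod_cast hL)
    rw [div_lt_iff₀ hδ] at this
    linarith
  have hdL : d * (n + 1 : ℕ) = 2 * π := by rw [hd]; field_simp
  -- grid points
  set a : ℕ → ℝ := fun i => d * i with ha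
  have ha0 : a 0 = 0 := by simp [ha]
  have haL : a (n + 1) = 2 * π := by rw [ha]; exact_mod_cast hdL
  have hamono : ∀ i : ℕ, a i ≤ a (i + 1) := fun i => by
    simp only [ha]; push_cast; nlinarith
  have hasucc : ∀ i : ℕ, a (i + 1) - a i = d := fun i => by simp only [ha]; push_cast; ring
  have ha_nonneg : ∀ i : ℕ, 0 ≤ a i := fun i => by simp only [ha]; positivity
  have ha_le : ∀ i : ℕ, i ≤ n + 1 → a i ≤ 2 * π := fun i hi => by
    rw [← haL]; simp only [ha]; exact mul_le_mul_of_nonneg_left (by exact_mod_cast hi) hdpos.le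
  -- rewrite the sum
  rw [cfl_sum_torus_eq_sum_range n (fun i j => f (2 * π * (i : ℝ) / (n + 1 : ℕ)) (2 * π * (j : ℝ) / (n + 1 : ℕ)))]
  have hgrid : ∀ i : ℕ, 2 * π * (i : ℝ) / (n + 1 : ℕ) = a i := fun i => by
    simp only [ha, hd]; ring
  simp only [hgrid]
  -- continuity facts
  have hfx : ∀ x : ℝ, Continuous fun y => f x y := fun x => hf.comp (Continuous.prodMk_right x)
  have hFj : ∀ (u v : ℝ), Continuous fun x => ∫ y in u..v, f x y := fun u v =>
    intervalIntegral.continuous_parametric_intervalIntegral_of_continuous' hf u v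
  -- split the outer integral
  have hsplit_inner : ∀ x : ℝ, ∫ y in (0 : ℝ)..2 * π, f x y =
      ∑ j ∈ range (n + 1), ∫ y in a j..a (j + 1), f x y := fun x => by
    rw [sum_integral_adjacent_intervals (fun k _ => (hfx x).intervalIntegrable _ _), ha0, haL]
  have houter : ∑ i ∈ range (n + 1), ∫ x in a i..a (i + 1), (∫ y in (0 : ℝ)..2 * π, f x y) =
      ∫ x in (0 : ℝ)..2 * π, ∫ y in (0 : ℝ)..2 * π, f x y := by
    rw [sum_integral_adjacent_intervals (fun k _ => (hFj _ _).intervalIntegrable _ _), ha0, haL]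
  have hsplit : ∫ x in (0 : ℝ)..2 * π, ∫ y in (0 : ℝ)..2 * π, f x y =
      ∑ i ∈ range (n + 1), ∑ j ∈ range (n + 1),
        ∫ x in a i..a (i + 1), ∫ y in a j..a (j + 1), f x y := by
    rw [← houter]
    refine Finset.sum_congr rfl fun i _ => ?_
    simp_rw [hsplit_inner]
    rw [intervalIntegral.integral_finsetSum]
    intro j _
    exact (hFj _ _).intervalIntegrable _ _
  rw [hsplit]
  -- per-cell estimate
  have hcell : ∀ i ∈ range (n + 1), ∀ j ∈ range (n + 1),
      |d ^ 2 * f (a i) (a j) - ∫ x in a i..a (i + 1), ∫ y in a j..a (j + 1), f x y| ≤ κ * d ^ 2 := by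
    intro i hi j hj
    rw [Finset.mem_range] at hi hj
    have hI : ∫ x in a i..a (i + 1), ∫ y in a j..a (j + 1), (f x y - f (a i) (a j)) =
        (∫ x in a i..a (i + 1), ∫ y in a j..a (j + 1), f x y) - d ^ 2 * f (a i) (a j) := by
      have h1 : (fun x => ∫ y in a j..a (j + 1), (f x y - f (a i) (a j))) =
          fun x => (∫ y in a j..a (j + 1), f x y) - d * f (a i) (a j) := by
        funext x
        rw [intervalIntegral.integral_sub ((hfx x).intervalIntegrable _ _) intervalIntegrable_const,
          intervalIntegral.integral_const, hasucc, smul_eq_mul]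
      rw [h1, intervalIntegral.integral_sub ((hFj _ _).intervalIntegrable _ _) intervalIntegrable_const,
        intervalIntegral.integral_const, hasucc, smul_eq_mul]
      ring
    rw [abs_sub_comm, ← hI]
    have hinner : ∀ x ∈ Set.uIoc (a i) (a (i + 1)),
        ‖∫ y in a j..a (j + 1), (f x y - f (a i) (a j))‖ ≤ κ * d := by
      intro x hx
      rw [Set.uIoc_of_le (hamono i)] at hx
      have hb : ∀ y ∈ Set.uIoc (a j) (a (j + 1)), ‖f x y - f (a i) (a j)‖ ≤ κ := by
        intro y hy
        rw [Set.uIoc_of_le (hamono j)] at hy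
        have hxK : (x, y) ∈ K := by
          refine ⟨⟨(ha_nonneg i).trans hx.1.le, hx.2.trans (ha_le (i + 1) hi)⟩,
            ⟨(ha_nonneg j).trans hy.1.le, hy.2.trans (ha_le (j + 1) hj)⟩⟩
        have haK : (a i, a j) ∈ K :=
          ⟨⟨ha_nonneg i, ha_le i hi.le⟩, ⟨ha_nonneg j, ha_le j hj.le⟩⟩
        have hdist : dist (x, y) (a i, a j) < δ := by
          rw [Prod.dist_eq, max_lt_iff, Real.dist_eq, Real.dist_eq]
          have h1 := hasucc i
          have h2 := hasucc j
          constructor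
          · rw [abs_of_nonneg (by linarith [hx.1])]; linarith [hx.2]
          · rw [abs_of_nonneg (by linarith [hy.1])]; linarith [hy.2]
        have := hδf (x, y) hxK (a i, a j) haK hdist
        rw [Real.dist_eq] at this
        simpa [Function.uncurry] using this.le
      have := intervalIntegral.norm_integral_le_of_norm_le_const hb
      rw [hasucc, abs_of_pos hdpos] at this
      exact this
    have := intervalIntegral.norm_integral_le_of_norm_le_const hinner
    rw [hasucc, abs_of_pos hdpos, Real.norm_eq_abs] at this
    calc _ ≤ κ * d * d := this
      _ = κ * d ^ 2 := by ring
  -- assemble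
  have hL2 : ((n + 1 : ℕ) : ℝ) ^ 2 = 4 * π ^ 2 / d ^ 2 := by
    have : d ^ 2 * ((n + 1 : ℕ) : ℝ) ^ 2 = 4 * π ^ 2 := by
      calc d ^ 2 * ((n + 1 : ℕ) : ℝ) ^ 2 = (d * (n + 1 : ℕ)) ^ 2 := by ring
        _ = 4 * π ^ 2 := by rw [hdL]; ring
    field_simp
    linarith
  have hpi : (0 : ℝ) < 4 * π ^ 2 := by positivity
  have hkey : (∑ i ∈ range (n + 1), ∑ j ∈ range (n + 1), f (a i) (a j)) / ((n + 1 : ℕ) : ℝ) ^ 2 =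
      (∑ i ∈ range (n + 1), ∑ j ∈ range (n + 1), d ^ 2 * f (a i) (a j)) / (4 * π ^ 2) := by
    rw [hL2]
    simp_rw [← Finset.mul_sum]
    field_simp
  rw [hkey, ← sub_div, abs_div, abs_of_pos hpi, div_le_iff₀ hpi, ← Finset.sum_sub_distrib]
  simp_rw [← Finset.sum_sub_distrib]
  calc |∑ i ∈ range (n + 1), ∑ j ∈ range (n + 1), (d ^ 2 * f (a i) (a j) -
          ∫ x in a i..a (i + 1), ∫ y in a j..a (j + 1), f x y)|
      ≤ ∑ i ∈ range (n + 1), |∑ j ∈ range (n + 1), (d ^ 2 * f (a i) (a j) -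
          ∫ x in a i..a (i + 1), ∫ y in a j..a (j + 1), f x y)| :=
        Finset.abs_sum_le_sum_abs _ _
    _ ≤ ∑ i ∈ range (n + 1), ∑ j ∈ range (n + 1), κ * d ^ 2 := by
        refine Finset.sum_le_sum fun i hi => ?_
        exact (Finset.abs_sum_le_sum_abs _ _).trans (Finset.sum_le_sum fun j hj => hcell i hi j hj)
    _ = κ * (d ^ 2 * ((n + 1 : ℕ) : ℝ) ^ 2) := by
        rw [Finset.sum_const, Finset.sum_const, Finset.card_range, nsmul_eq_mul, nsmul_eq_mul]
        push_cast; ring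
    _ = κ * (4 * π ^ 2) := by rw [hL2]; field_simp


/-! ### The free sourced pressure is the grid average of the BdG pressure density -/

/-- **`p_L` is a grid average** (`L ≥ 3`, `β ≠ 0`): by the closed form
`Re Tr e^{-βH_L(s)} = 2^{2L²} Π_k e^{-βξ_k}(1 + cosh βE_k)/2`,
`log Re Tr e^{-βH_L(s)}/(βL²) = (1/L²) Σ_k [2 log 2/β − ξ_k + (1/β) log((1 + cosh βE_k)/2)]`.
[cite: VondelftRalph2001, §4.2] -/
theorem cfl_freeSourcedPressure_eq_gridAverage {L : ℕ} [NeZero L] (hL : 3 ≤ L) {β : ℝ} (hβ : β ≠ 0)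
    (μ s : ℝ) :
    Real.log (Matrix.partitionFn β (dWaveSourceTorus L 0 μ s)).re / (β * (L : ℝ) ^ 2) =
      (∑ k : TorusSite 2 L, (2 * Real.log 2 / β - (torusBand L k - μ) +
        1 / β * Real.log ((1 + Real.cosh (β * Real.sqrt ((torusBand L k - μ) ^ 2 +
          (2 * Real.sqrt 2 * s * dWaveGap k) ^ 2))) / 2))) / (L : ℝ) ^ 2 := by
  rw [partitionFn_dWaveSourceTorus_zero_re hL β μ s, card_orb_fermionTorus_two]
  have hfac : ∀ k : TorusSite 2 L, Real.exp (-(β * (torusBand L k - μ))) *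
      ((1 + Real.cosh (β * Real.sqrt ((torusBand L k - μ) ^ 2 + (2 * Real.sqrt 2 * s * dWaveGap k) ^ 2))) / 2)
        ≠ 0 := fun k => (bdgModeFactor_pos β _ _).ne'
  have hcosh : ∀ k : TorusSite 2 L, (1 + Real.cosh (β * Real.sqrt ((torusBand L k - μ) ^ 2 +
      (2 * Real.sqrt 2 * s * dWaveGap k) ^ 2))) / 2 ≠ 0 := fun k => by
    have := Real.cosh_pos (β * Real.sqrt ((torusBand L k - μ) ^ 2 + (2 * Real.sqrt 2 * s * dWaveGap k) ^ 2))
    positivity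
  have hpow : (0 : ℝ) < (2 : ℝ) ^ (2 * L ^ 2) := by positivity
  rw [Real.log_mul hpow.ne' (Finset.prod_ne_zero_iff.2 fun k _ => hfac k), Real.log_pow,
    Real.log_prod (s := Finset.univ) (hf := fun k _ => hfac k)]
  simp_rw [Real.log_mul (Real.exp_pos _).ne' (hcosh _), Real.log_exp]
  have hL0 : (L : ℝ) ≠ 0 := by exact_mod_cast NeZero.ne L
  -- `|(ℤ/L)²| = L²` (landed as `EnslavedA1g.card_torusSite_two`; inlined to keep imports minimal)
  have hcard : Fintype.card (TorusSite 2 L) = L ^ 2 := by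
    rw [Fintype.card_fun, ZMod.card, Fintype.card_fin]
  rw [div_eq_div_iff (mul_ne_zero hβ (pow_ne_zero 2 hL0)) (pow_ne_zero 2 hL0)]
  simp only [Finset.sum_add_distrib, Finset.sum_sub_distrib, Finset.sum_const, Finset.card_univ,
    hcard, ← Finset.mul_sum, Finset.sum_neg_distrib, nsmul_eq_mul]
  push_cast
  field_simp
  ring

/-! ### Layer 1: the thermodynamic limit of the free sourced pressure -/

/-- The BdG pressure density `F(θ₁,θ₂)` is jointly continuous (`β ≠ 0` not even needed: `1 + cosh ≥ 2 > 0`).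
[folklore] -/
theorem cfl_continuous_bdgPressureDensity (β μ s : ℝ) :
    Continuous (Function.uncurry fun θ₁ θ₂ : ℝ =>
      (2 * Real.log 2 / β - (-2 * (Real.cos θ₁ + Real.cos θ₂) - μ) +
            1 / β * Real.log ((1 + Real.cosh (β * Real.sqrt ((-2 * (Real.cos θ₁ + Real.cos θ₂) - μ) ^ 2 +
              (2 * Real.sqrt 2 * s * (Real.cos θ₁ - Real.cos θ₂)) ^ 2))) / 2))) := by
  show Continuous fun p : ℝ × ℝ =>
      (2 * Real.log 2 / β - (-2 * (Real.cos p.1 + Real.cos p.2) - μ) +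
            1 / β * Real.log ((1 + Real.cosh (β * Real.sqrt ((-2 * (Real.cos p.1 + Real.cos p.2) - μ) ^ 2 +
              (2 * Real.sqrt 2 * s * (Real.cos p.1 - Real.cos p.2)) ^ 2))) / 2))
  have h1 : Continuous fun p : ℝ × ℝ => (-2 * (Real.cos p.1 + Real.cos p.2) - μ) := by fun_prop
  have h2 : Continuous fun p : ℝ × ℝ => (1 + Real.cosh (β * Real.sqrt ((-2 * (Real.cos p.1 + Real.cos p.2) - μ) ^ 2 +
      (2 * Real.sqrt 2 * s * (Real.cos p.1 - Real.cos p.2)) ^ 2))) / 2 := by fun_prop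
  have h3 : ∀ p : ℝ × ℝ, (1 + Real.cosh (β * Real.sqrt ((-2 * (Real.cos p.1 + Real.cos p.2) - μ) ^ 2 +
      (2 * Real.sqrt 2 * s * (Real.cos p.1 - Real.cos p.2)) ^ 2))) / 2 ≠ 0 := fun p => by
    have := Real.cosh_pos (β * Real.sqrt ((-2 * (Real.cos p.1 + Real.cos p.2) - μ) ^ 2 + (2 * Real.sqrt 2 * s * (Real.cos p.1 - Real.cos p.2)) ^ 2))
    positivity
  exact (continuous_const.sub h1).add (continuous_const.mul (h2.log h3))

/-- **Layer 1 (registered helper stub `cfl_freeSourcedPressure_limit`): thermodynamic limit of the free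
`d`-wave-sourced BdG pressure.** For `β > 0` and all `μ, s`:
`log Re Tr e^{-β dWaveSourceTorus L 0 μ s}/(βL²) → (1/4π²) ∫₀^{2π}∫₀^{2π} F(θ₁,θ₂) dθ₂ dθ₁` as `L → ∞`, with
`F = 2 log 2/β − ξ + (1/β) log((1 + cosh βE)/2)`, `ξ = −2(cos θ₁ + cos θ₂) − μ`,
`E = √(ξ² + (2√2 s (cos θ₁ − cos θ₂))²)` — the Brillouin-zone average of the BdG pressure density.
[cite: VondelftRalph2001, §4.2] -/
theorem cfl_freeSourcedPressure_limit : ∀ (β μ s : ℝ), 0 < β → ∀ κ : ℝ, 0 < κ → ∃ L₀ : ℕ, ∀ (L : ℕ) [NeZero L], L₀ ≤ L → |Real.log (Matrix.partitionFn β (dWaveSourceTorus L 0 μ s)).re / (β * (L : ℝ) ^ 2) - (∫ θ₁ in (0 : ℝ)..2 * π, ∫ θ₂ in (0 : ℝ)..2 * π, (2 * Real.log 2 / β - (-2 * (Real.cos θ₁ + Real.cos θ₂) - μ) + 1 / β * Real.log ((1 + Real.cosh (β * Real.sqrt ((-2 * (Real.cos θ₁ + Real.cos θ₂) - μ) ^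 2 + (2 * Real.sqrt 2 * s * (Real.cos θ₁ - Real.cos θ₂)) ^ 2))) / 2))) / (4 * π ^ 2)| ≤ κ := by
  intro β μ s hβ κ hκ
  obtain ⟨L₁, hL₁⟩ := cfl_riemann_sum_torus (cfl_continuous_bdgPressureDensity β μ s) κ hκ
  refine ⟨max L₁ 3, fun L _ hL => ?_⟩
  have hL3 : 3 ≤ L := le_of_max_le_right hL
  rw [cfl_freeSourcedPressure_eq_gridAverage hL3 hβ.ne' μ s]
  have hsum : (∑ k : TorusSite 2 L, (2 * Real.log 2 / β - (torusBand L k - μ) +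
        1 / β * Real.log ((1 + Real.cosh (β * Real.sqrt ((torusBand L k - μ) ^ 2 +
          (2 * Real.sqrt 2 * s * dWaveGap k) ^ 2))) / 2))) =
      ∑ k : Fin 2 → ZMod L, (fun θ₁ θ₂ : ℝ =>
        (2 * Real.log 2 / β - (-2 * (Real.cos θ₁ + Real.cos θ₂) - μ) +
            1 / β * Real.log ((1 + Real.cosh (β * Real.sqrt ((-2 * (Real.cos θ₁ + Real.cos θ₂) - μ) ^ 2 +
              (2 * Real.sqrt 2 * s * (Real.cos θ₁ - Real.cos θ₂)) ^ 2))) / 2)))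
        (2 * π * ((k 0).val : ℝ) / L) (2 * π * ((k 1).val : ℝ) / L) := by
    refine Finset.sum_congr rfl fun k _ => ?_
    simp only [torusBand, dWaveGap, latticeMomentum, Fin.sum_univ_two]
  rw [hsum]
  exact hL₁ L (le_of_max_le_left hL)

end Summit.HubbardSuperconductivity.HubbardSuperconductivity.Theorems.TwSeededEnsembleEquivalenceR.ColdFloorLine
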